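import Summits.Ventures.PercRepro.RankLevelSetLevelSixHeavyCellSq27DI2V
import Summits.Ventures.PercRepro.RankLevelSetCoreSixColoopFreeUnion
import Summits.Ventures.PercRepro.RankLevelSetLevelSixCapGlue25
import Summits.Ventures.PercRepro.TriangleCapEightI
import Summits.Ventures.PercRepro.S1TrianglePlusSharp
import Summits.Ventures.PercRepro.S1SeriesLever14
import Summits.Ventures.PercRepro.RankLevelSetCircuitUnionRank
import Summits.Ventures.PercRepro.RankLevelSetLevelSixArithHeavySq20TF10A
import Summits.Ventures.PercRepro.RankLevelSetLevelSixArithHeavySq19TF10A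
import Summits.Ventures.PercRepro.RankLevelSetDepCountHeavyB
import Summits.Ventures.PercRepro.RankLevelSetFourCircuitNullityFourSharp
import Summits.Ventures.PercRepro.RankLevelSetFiveCircuitNullityFourSharp
import Summits.Ventures.PercRepro.RankLevelSetLevelSixArithHeavySq20TN8_18TN10A

/-!
# PercRepro — THE 23 ROW, CORANK 10, PART B: THE SCALED CELLS AT LEVELS 3, 4 AND THE EVERY-CORE TERMINAL AT LEVEL 5 (p8 g11, S3)

`proofs/SUBCLAIM-S3-p8.md` §3y. `(phiK (p + 3) 6 / 8)·#U ≤ #Y` on a coloop-free `e`-free core of rank `p ≥ 20`, corank `10`, on the cell `sq27di2v` with the `H`-term factor `p + 10 − 16` (`ν₁ = 7`, `j = 2`, `j′ = 1`, `|UG| ≤ 19`, `|UH| ≤ 16`, `Kn/Kd = 13888/1000`; `D = C(p + 9, 6)`; caps `s₃ ≤ 17`, `s₄ ≤ 124`, `s₅ ≤ 1092`, `s₆ ≤ 3753`, `s₇ ≤ 8393` at `n₀ = 30`; parts RankLevelSetLevelSixArithHeavySq20TF10A). Axioms: standard.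

`proofs/SUBCLAIM-S3-p8.md` §3y. `(phiK (p + 4) 6 / 16)·#U ≤ #Y` on a coloop-free `e`-free core of rank `p ≥ 19`, corank `10`, on the cell `sq27di2v` with the `H`-term factor `p + 10 − 16` (`ν₁ = 7`, `j = 2`, `j′ = 1`, `|UG| ≤ 19`, `|UH| ≤ 16`, `Kn/Kd = 9115/1000`; `D = C(p + 10, 6)`; caps `s₃ ≤ 17`, `s₄ ≤ 124`, `s₅ ≤ 1099`, `s₆ ≤ 3786`, `s₇ ≤ 8482` at `n₀ = 29`; parts RankLevelSetLevelSixArithHeavySq19TF10A). Axioms: standard.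

`proofs/SUBCLAIM-S3-p8.md` §3y. `(phiK (p + 5) 6 / 32)·#U ≤ #Y` on every `e`-free core of rank `p ≥ 18`, corank `10`, on the cell `sq27di2v` with the `H`-term factor `p + 10 − 17` (`ν₁ = 8`, `j = 2`, `j′ = 1`, `|UG| ≤ 20`, `|UH| ≤ 17`, `Kn/Kd = 5280/1000`; `D = C(p + 11, 6)`; caps `s₃ ≤ 20`, `s₄ ≤ 167`, `s₅ ≤ 1365`, `s₆ ≤ 5005`, `s₇ ≤ 11440` at `n₀ = 28`; parts RankLevelSetLevelSixArithHeavySq18TN10A). Axioms: standard.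
-/

open scoped Matroid

namespace PercRepro

namespace ThmN

open Set

variable {α : Type}

-- ===== RankLevelSetLevelSixT23S3Cf10 =====


/-- **THE 3-TIMES SCALED COLOOP-FREE CELL `(p ≥ 20, 10)` of the `23` row at corank `10`** (level 3, `phiK (p + 3) 6 / 8`, `D = C(p + 9, 6)`). -/
theorem c025_core_six_t23_scaled3_cf10 (M : Matroid α) [M.Finite] (p : ℕ) (hp : 20 ≤ p) (hcf : ∀ e ∈ M.E, ¬ M.IsColoop e)
    (hR : M.eRank = (p : ℕ∞)) (hn : M.E.ncard = p + 10)
    (hfree : ∀ e ∈ M.E, ∃ A ⊆ M.E \ {e}, e ∉ M.closure A ∧ e ∉ M.closure ((M.E \ {e}) \ A)) :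
    phiK (p + 3) 6 / 8 * (Matroid.topCount M p 6 : ℚ) ≤ (Matroid.midCount M p 6 : ℚ) := by
  classical
  have hd : M.E.encard = M.eRank + (10 : ℕ) := by
    rw [hR, ← M.ground_finite.cast_ncard_eq, hn]
    push_cast
    ring
  have hL : ∀ e ∈ M.E, ¬ M.IsLoop e := not_isLoop_of_free M hfree
  have hs : ∀ e ∈ M.E, ∀ f ∈ M.E, e ≠ f → M.eRk {e, f} = 2 := by
    intro e he f hf hef
    have h2 : (2 : ℕ∞) ≤ M.eRk {e, f} :=
      two_le_eRk_of_two_le_ncard_of_free M hfree (pair_subset he hf) (by rw [ncard_pair hef])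
    have h3 : M.eRk {e, f} ≤ 2 := by
      have := M.eRk_le_encard {e, f}
      rwa [encard_pair hef] at this
    exact le_antisymm h3 h2
  have hc : ∀ X ⊆ M.E, M.eRk X ≤ ((6 - 2 : ℕ) : ℕ∞) → (X.ncard : ℕ∞) ≤ M.eRk X + cnull 4 :=
    fun X hX hr => nullity_cap_core M hfree 4 (le_refl 4) X hX (by simpa using hr)
  have hc6 : cnull 4 + 1 ≤ 7 := by simp [cnull]
  have hcj : ∀ X ⊆ M.E, M.eRk X ≤ ((6 - 2 - 1 : ℕ) : ℕ∞) → (X.ncard : ℕ∞) ≤ M.eRk X + cnull (3) :=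
    fun X hX hr => nullity_cap_core M hfree 3 (by omega) X hX
      (by rwa [show (6 - 2 - 1 : ℕ) = 3 by omega] at hr)
  have hcj' : ∀ X ⊆ M.E, M.eRk X ≤ ((6 - 1 - 1 - 1 : ℕ) : ℕ∞) → (X.ncard : ℕ∞) ≤ M.eRk X + cnull (3) :=
    fun X hX hr => nullity_cap_core M hfree 3 (by omega) X hX
      (by rwa [show (6 - 1 - 1 - 1 : ℕ) = 3 by omega] at hr)
  have hUG : (Matroid.UG M 6 7).ncard ≤ 19 := by
    have := Matroid.ncard_UG_le_cf (M := M) (q := 6) (ν₁ := 7) (j := 2) (by norm_num) hcf hR hn (by omega) hc hc6 hcj (by norm_num [cnull])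
    simpa using this
  have hUH : (Matroid.UH M 6 7).ncard ≤ 16 := by
    have := Matroid.ncard_UH_le_cf (M := M) (q := 6) (ν₁ := 7) (j' := 1) (by norm_num) hcf hR hn (by omega) hc hc6 hcj' (by norm_num [cnull])
    simpa using this
  have hΦ : phiK (p + 3) 6 / 8 ≤ (2 : ℚ) ^ (p + 6) / (((p + 9).choose 6 : ℕ) : ℚ) := by
    have h := phiK_le_two_pow_div_six (p + 3)
    rw [show p + 3 + 6 = p + 9 by omega] at h
    have h8 : (2 : ℚ) ^ (p + 9) = 2 ^ (p + 6) * 8 := by rw [show p + 9 = p + 6 + 3 by omega, pow_add]; norm_num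
    rw [h8] at h
    calc phiK (p + 3) 6 / 8 ≤ (2 : ℚ) ^ (p + 6) * 8 / (((p + 9).choose 6 : ℕ) : ℚ) / 8 := by gcongr
      _ = (2 : ℚ) ^ (p + 6) / (((p + 9).choose 6 : ℕ) : ℚ) := by ring
  exact c025_core_six_heavy_cell_sq27di2v M p 10 7 19 16 0 13888 1000 16 1092 124 17 3753 8393
      ((p + 9).choose 6) (Nat.choose_pos (by omega)) (phiK (p + 3) 6 / 8) hΦ (by norm_num) (by omega)
      (by norm_num) hUG hUH (by omega) (Or.inl (by norm_num)) (by norm_num) (by norm_num) (by norm_num)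
      (s3_cf_of M hfree hcf (d := 9) (by simpa using hd) 30 17 (by norm_num) (by omega) (by decide) (by decide) (by decide))
      ((S1.ncard_fourCircuits_le_gb14 10 M hfree hd 30 (by rw [coloops_eq_empty_of_forall M hcf, Set.sdiff_empty, hn]; omega)).trans (by decide))
      (s5_cf_of M hfree hcf (d := 9) (by rw [hd]; norm_num) 30 910 1092 (by norm_num) (by omega) (by decide) (by omega))
      (s6_cf_of M hfree hcf (d := 9) (by rw [hd]; norm_num) 30 3003 3753 (by norm_num) (by omega) (by decide) (by omega))
      (s7_cf_of M hfree hcf (d := 9) (by rw [hd]; norm_num) 30 6435 8393 (by norm_num) (by omega) (by decide) (by omega))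
      (Or.inl (tail_six_heavy_sq20TF10_10 p hp)) hR hn hfree (level_six_poly_heavy_sq20TF10_10 p hp)

-- ===== RankLevelSetLevelSixT23S4Cf10 =====


/-- **THE 4-TIMES SCALED COLOOP-FREE CELL `(p ≥ 19, 10)` of the `23` row at corank `10`** (level 4, `phiK (p + 4) 6 / 16`, `D = C(p + 10, 6)`). -/
theorem c025_core_six_t23_scaled4_cf10 (M : Matroid α) [M.Finite] (p : ℕ) (hp : 19 ≤ p) (hcf : ∀ e ∈ M.E, ¬ M.IsColoop e)
    (hR : M.eRank = (p : ℕ∞)) (hn : M.E.ncard = p + 10)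
    (hfree : ∀ e ∈ M.E, ∃ A ⊆ M.E \ {e}, e ∉ M.closure A ∧ e ∉ M.closure ((M.E \ {e}) \ A)) :
    phiK (p + 4) 6 / 16 * (Matroid.topCount M p 6 : ℚ) ≤ (Matroid.midCount M p 6 : ℚ) := by
  classical
  have hd : M.E.encard = M.eRank + (10 : ℕ) := by
    rw [hR, ← M.ground_finite.cast_ncard_eq, hn]
    push_cast
    ring
  have hL : ∀ e ∈ M.E, ¬ M.IsLoop e := not_isLoop_of_free M hfree
  have hs : ∀ e ∈ M.E, ∀ f ∈ M.E, e ≠ f → M.eRk {e, f} = 2 := by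
    intro e he f hf hef
    have h2 : (2 : ℕ∞) ≤ M.eRk {e, f} :=
      two_le_eRk_of_two_le_ncard_of_free M hfree (pair_subset he hf) (by rw [ncard_pair hef])
    have h3 : M.eRk {e, f} ≤ 2 := by
      have := M.eRk_le_encard {e, f}
      rwa [encard_pair hef] at this
    exact le_antisymm h3 h2
  have hc : ∀ X ⊆ M.E, M.eRk X ≤ ((6 - 2 : ℕ) : ℕ∞) → (X.ncard : ℕ∞) ≤ M.eRk X + cnull 4 :=
    fun X hX hr => nullity_cap_core M hfree 4 (le_refl 4) X hX (by simpa using hr)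
  have hc6 : cnull 4 + 1 ≤ 7 := by simp [cnull]
  have hcj : ∀ X ⊆ M.E, M.eRk X ≤ ((6 - 2 - 1 : ℕ) : ℕ∞) → (X.ncard : ℕ∞) ≤ M.eRk X + cnull (3) :=
    fun X hX hr => nullity_cap_core M hfree 3 (by omega) X hX
      (by rwa [show (6 - 2 - 1 : ℕ) = 3 by omega] at hr)
  have hcj' : ∀ X ⊆ M.E, M.eRk X ≤ ((6 - 1 - 1 - 1 : ℕ) : ℕ∞) → (X.ncard : ℕ∞) ≤ M.eRk X + cnull (3) :=
    fun X hX hr => nullity_cap_core M hfree 3 (by omega) X hX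
      (by rwa [show (6 - 1 - 1 - 1 : ℕ) = 3 by omega] at hr)
  have hUG : (Matroid.UG M 6 7).ncard ≤ 19 := by
    have := Matroid.ncard_UG_le_cf (M := M) (q := 6) (ν₁ := 7) (j := 2) (by norm_num) hcf hR hn (by omega) hc hc6 hcj (by norm_num [cnull])
    simpa using this
  have hUH : (Matroid.UH M 6 7).ncard ≤ 16 := by
    have := Matroid.ncard_UH_le_cf (M := M) (q := 6) (ν₁ := 7) (j' := 1) (by norm_num) hcf hR hn (by omega) hc hc6 hcj' (by norm_num [cnull])
    simpa using this
  have hΦ : phiK (p + 4) 6 / 16 ≤ (2 : ℚ) ^ (p + 6) / (((p + 10).choose 6 : ℕ) : ℚ) := by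
    have h := phiK_le_two_pow_div_six (p + 4)
    rw [show p + 4 + 6 = p + 10 by omega] at h
    have h8 : (2 : ℚ) ^ (p + 10) = 2 ^ (p + 6) * 16 := by rw [show p + 10 = p + 6 + 4 by omega, pow_add]; norm_num
    rw [h8] at h
    calc phiK (p + 4) 6 / 16 ≤ (2 : ℚ) ^ (p + 6) * 16 / (((p + 10).choose 6 : ℕ) : ℚ) / 16 := by gcongr
      _ = (2 : ℚ) ^ (p + 6) / (((p + 10).choose 6 : ℕ) : ℚ) := by ring
  exact c025_core_six_heavy_cell_sq27di2v M p 10 7 19 16 0 9115 1000 16 1099 124 17 3786 8482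
      ((p + 10).choose 6) (Nat.choose_pos (by omega)) (phiK (p + 4) 6 / 16) hΦ (by norm_num) (by omega)
      (by norm_num) hUG hUH (by omega) (Or.inl (by norm_num)) (by norm_num) (by norm_num) (by norm_num)
      (s3_cf_of M hfree hcf (d := 9) (by simpa using hd) 29 17 (by norm_num) (by omega) (by decide) (by decide) (by decide))
      ((S1.ncard_fourCircuits_le_gb14 10 M hfree hd 29 (by rw [coloops_eq_empty_of_forall M hcf, Set.sdiff_empty, hn]; omega)).trans (by decide))
      (s5_cf_of M hfree hcf (d := 9) (by rw [hd]; norm_num) 29 910 1099 (by norm_num) (by omega) (by decide) (by omega))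
      (s6_cf_of M hfree hcf (d := 9) (by rw [hd]; norm_num) 29 3003 3786 (by norm_num) (by omega) (by decide) (by omega))
      (s7_cf_of M hfree hcf (d := 9) (by rw [hd]; norm_num) 29 6435 8482 (by norm_num) (by omega) (by decide) (by omega))
      (Or.inl (tail_six_heavy_sq19TF10_10 p hp)) hR hn hfree (level_six_poly_heavy_sq19TF10_10 p hp)

-- ===== RankLevelSetLevelSixT23S5Every10 =====


/-- **THE 5-TIMES SCALED EVERY-CORE TERMINAL `(p ≥ 18, 10)` of the `23` row at corank `10`** (level 5, `phiK (p + 5) 6 / 32`, `D = C(p + 11, 6)`). -/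
theorem c025_core_six_t23_scaled5_every10 (M : Matroid α) [M.Finite] (p : ℕ) (hp : 18 ≤ p)
    (hR : M.eRank = (p : ℕ∞)) (hn : M.E.ncard = p + 10)
    (hfree : ∀ e ∈ M.E, ∃ A ⊆ M.E \ {e}, e ∉ M.closure A ∧ e ∉ M.closure ((M.E \ {e}) \ A)) :
    phiK (p + 5) 6 / 32 * (Matroid.topCount M p 6 : ℚ) ≤ (Matroid.midCount M p 6 : ℚ) := by
  classical
  have hd : M.E.encard = M.eRank + (10 : ℕ) := by
    rw [hR, ← M.ground_finite.cast_ncard_eq, hn]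
    push_cast
    ring
  have hL : ∀ e ∈ M.E, ¬ M.IsLoop e := not_isLoop_of_free M hfree
  have hs : ∀ e ∈ M.E, ∀ f ∈ M.E, e ≠ f → M.eRk {e, f} = 2 := by
    intro e he f hf hef
    have h2 : (2 : ℕ∞) ≤ M.eRk {e, f} :=
      two_le_eRk_of_two_le_ncard_of_free M hfree (pair_subset he hf) (by rw [ncard_pair hef])
    have h3 : M.eRk {e, f} ≤ 2 := by
      have := M.eRk_le_encard {e, f}
      rwa [encard_pair hef] at this
    exact le_antisymm h3 h2
  have hc : ∀ X ⊆ M.E, M.eRk X ≤ ((6 - 2 : ℕ) : ℕ∞) → (X.ncard : ℕ∞) ≤ M.eRk X + cnull 4 :=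
    fun X hX hr => nullity_cap_core M hfree 4 (le_refl 4) X hX (by simpa using hr)
  have hc6 : cnull 4 + 1 ≤ 8 := by simp [cnull]
  have hcj : ∀ X ⊆ M.E, M.eRk X ≤ ((6 - 2 - 1 : ℕ) : ℕ∞) → (X.ncard : ℕ∞) ≤ M.eRk X + cnull (3) :=
    fun X hX hr => nullity_cap_core M hfree 3 (by omega) X hX
      (by rwa [show (6 - 2 - 1 : ℕ) = 3 by omega] at hr)
  have hcj' : ∀ X ⊆ M.E, M.eRk X ≤ ((6 - 1 - 1 - 1 : ℕ) : ℕ∞) → (X.ncard : ℕ∞) ≤ M.eRk X + cnull (3) :=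
    fun X hX hr => nullity_cap_core M hfree 3 (by omega) X hX
      (by rwa [show (6 - 1 - 1 - 1 : ℕ) = 3 by omega] at hr)
  have hUG : (Matroid.UG M 6 8).ncard ≤ 20 := by
    have := Matroid.ncard_UG_le (M := M) (q := 6) (ν₁ := 8) (j := 2) (by norm_num) hd hc hc6 hcj (by norm_num [cnull])
    simpa using this
  have hUH : (Matroid.UH M 6 8).ncard ≤ 17 := by
    have := Matroid.ncard_UH_le (M := M) (q := 6) (ν₁ := 8) (j' := 1) (by norm_num) hd hc hc6 hcj' (by norm_num [cnull])
    simpa using this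
  have hΦ : phiK (p + 5) 6 / 32 ≤ (2 : ℚ) ^ (p + 6) / (((p + 11).choose 6 : ℕ) : ℚ) := by
    have h := phiK_le_two_pow_div_six (p + 5)
    rw [show p + 5 + 6 = p + 11 by omega] at h
    have h8 : (2 : ℚ) ^ (p + 11) = 2 ^ (p + 6) * 32 := by rw [show p + 11 = p + 6 + 5 by omega, pow_add]; norm_num
    rw [h8] at h
    calc phiK (p + 5) 6 / 32 ≤ (2 : ℚ) ^ (p + 6) * 32 / (((p + 11).choose 6 : ℕ) : ℚ) / 32 := by gcongr
      _ = (2 : ℚ) ^ (p + 6) / (((p + 11).choose 6 : ℕ) : ℚ) := by ring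
  exact c025_core_six_heavy_cell_sq27di2v M p 10 8 20 17 0 5280 1000 16 1365 167 20 5005 11440
      ((p + 11).choose 6) (Nat.choose_pos (by omega)) (phiK (p + 5) 6 / 32) hΦ (by norm_num) (by omega)
      (by norm_num) hUG hUH (by omega) (Or.inl (by norm_num)) (by norm_num) (by norm_num) (by norm_num)
      ((TriangleCap.core_ncard_triangles_le_cq3 M hfree hd).trans (by decide))
      ((ncard_fourCircuits_le_avgChain14 10 M hfree hd).trans (by decide))
      ((S1.ncard_fiveCircuits_le_avgChain5c 10 M hfree hd).trans (by decide))
      ((Matroid.ncard_circuits_le_choose_of_encard M hd 5).trans (by decide))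
      ((Matroid.ncard_circuits_le_choose_of_encard M hd 6).trans (by decide))
      (Or.inl (tail_six_heavy_sq18TN10_10 p hp)) hR hn hfree (level_six_poly_heavy_sq18TN10_10 p hp)

end ThmN

end PercRepro
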